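import Mathlib
import Summits.Ventures.PercRepro2.Defs
import Summits.Ventures.PercRepro2.Graph
import Summits.Ventures.PercRepro2.HullDefs
import Summits.Ventures.PercRepro2.SwSide

/-!
# The rigid side injection (RS) is a theorem (blind cell PercRepro2, night-4 g6, 2026-08-24;
proofs/NIGHT4-BRIDGE.md §11, §14, §14.1; proofs/NIGHT4-G6.md §1)

Free fibre (uniform 2-colouring, blue = `Hull.blue ζ`), marks `l`, `c`, `o`, `A = C_R(l)`,
`B = C_B(l)`.  Statement (RS): an injection of `{o ∈ A ∖ B, c ∈ B ∖ A}` into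
`{o ∈ A ∖ B, c ∈ A ∖ B}` under which EVERY RED EDGE inside the red cluster of `c` of the source is
blue in the image (`exists_rigidSide`).  It is the rigid (edge) form of row (SW-side)
(`SwSide.card_side_le`, whose conclusion is only `C_R(c) ⊆ C_B(c)'`), and it is the ingredient the
seventh cut-vertex placement `{l, o} ∣ h` of the rigid block reduction of row 2′SW-ALL was missing.

PROOF.  By Hall it suffices that for every up-set `𝓕` of edge sets
`#{o ∈ A∖B, c ∈ B∖A, red_in(C_R(c)) ∈ 𝓕} ≤ #{o ∈ A∖B, c ∈ A∖B, blue ∈ 𝓕}` (`card_rigidSide_le`).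
The colour swap turns the left side into `#{o ∈ B∖A, c ∈ A∖B, blue_in(C_B(c)) ∈ 𝓕}`
(`blueIn_blue`), and `blue_in(C_B(c))` is a function of the DATUM of `c` — the colouring on the
edges touching `C_B(c)`, `SwSide.datum` (`blueIn_datum`) — so the class inequality of (SW-side)
(Harris twice and the colour swap off the edges touching `C_B(c)`, on every datum class with
`l ∉ C_B(c)`: `SwSide.cnt_class_le`) applies to the predicate `blue_in(C_B(c)) ∈ 𝓕` exactly as it
applied to `C_B(c) ∈ 𝓥` (`card_oneSided_le_datum`, the one-sided inequality for an arbitrary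
predicate on the datum).  Cancelling the common part `o ∈ A ∩ B` gives
`… ≤ #{o ∈ A∖B, c ∈ A∖B, blue_in(C_B(c)) ∈ 𝓕}`, and `blue_in(C_B(c)) ⊆ blue` with `𝓕` an up-set
finishes.
-/

namespace Summit.Ventures.PercRepro2

namespace RigidSide

open Hull SwSide

open scoped Classical

variable {V : Type*} {E : Type*} [Fintype E] [DecidableEq E]

variable (ends : E → Sym2 V)

/-- The blue edge set of a configuration. -/
def blueF (ζ : Config E) : Finset E := Finset.univ.filter fun e => ζ e = false

omit [DecidableEq E] in
/-- Membership in `blueF`. -/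
lemma mem_blueF {ζ : Config E} {e : E} : e ∈ blueF ζ ↔ ζ e = false := by simp [blueF]

/-- The blue edges inside the blue cluster of `c`. -/
noncomputable def blueIn (c : V) (ζ : Config E) : Finset E :=
  Finset.univ.filter fun e => e ∈ within ends (cluster ends (blue ζ) c) ∧ ζ e = false

/-- The red edges inside the red cluster of `c`. -/
noncomputable def redIn (c : V) (ζ : Config E) : Finset E :=
  Finset.univ.filter fun e => e ∈ within ends (cluster ends ζ c) ∧ ζ e = true

omit [DecidableEq E] in
/-- Membership in `blueIn`. -/
lemma mem_blueIn {c : V} {ζ : Config E} {e : E} :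
    e ∈ blueIn ends c ζ ↔ e ∈ within ends (cluster ends (blue ζ) c) ∧ ζ e = false := by
  simp [blueIn]

omit [DecidableEq E] in
/-- Membership in `redIn`. -/
lemma mem_redIn {c : V} {ζ : Config E} {e : E} :
    e ∈ redIn ends c ζ ↔ e ∈ within ends (cluster ends ζ c) ∧ ζ e = true := by
  simp [redIn]

omit [DecidableEq E] in
/-- The blue edges inside `C_B(c)` of the swap are the red edges inside `C_R(c)`. -/
lemma blueIn_blue (c : V) (ζ : Config E) : blueIn ends c (blue ζ) = redIn ends c ζ := by
  ext e
  simp only [mem_blueIn, mem_redIn, blue_blue, blue_apply]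
  constructor
  · rintro ⟨h1, h2⟩
    refine ⟨h1, ?_⟩
    revert h2; cases ζ e <;> simp
  · rintro ⟨h1, h2⟩
    refine ⟨h1, ?_⟩
    rw [h2]; rfl

omit [DecidableEq E] in
/-- `blue_in(C_B(c))` is a function of the datum of `c`: the datum keeps the colouring on the edges
touching `C_B(c)`, which contain the edges inside it. -/
lemma blueIn_datum (c : V) (ζ : Config E) :
    blueIn ends c (datum ends c ζ) = blueIn ends c ζ := by
  ext e
  simp only [mem_blueIn, cluster_blue_datum]
  constructor
  · rintro ⟨h1, h2⟩
    refine ⟨h1, ?_⟩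
    have ht : e ∈ touches ends (cluster ends (blue ζ) c) := within_subset_touches ends _ h1
    simpa [datum, ht] using h2
  · rintro ⟨h1, h2⟩
    refine ⟨h1, ?_⟩
    have ht : e ∈ touches ends (cluster ends (blue ζ) c) := within_subset_touches ends _ h1
    simp [datum, ht, h2]

/-- **The one-sided side inequality for an arbitrary predicate on the datum of `h`**:
`#{o ∈ B, h ∈ A ∖ B, P(datum)} ≤ #{o ∈ A, h ∈ A ∖ B, P(datum)}` — the proof of
`SwSide.card_oneSided_le` verbatim, the family `𝓥` of blue clusters replaced by a predicate `P` on
the datum (both are constant on the datum classes). -/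
theorem card_oneSided_le_datum (l h o : V) (P : Config E → Prop) :
    (Finset.univ.filter fun ζ : Config E =>
        o ∈ cluster ends (blue ζ) l ∧ h ∈ cluster ends ζ l ∧ h ∉ cluster ends (blue ζ) l ∧
          P (datum ends h ζ)).card ≤
      (Finset.univ.filter fun ζ : Config E =>
        o ∈ cluster ends ζ l ∧ h ∈ cluster ends ζ l ∧ h ∉ cluster ends (blue ζ) l ∧
          P (datum ends h ζ)).card := by
  rw [Finset.card_eq_sum_card_fiberwise (f := datum ends h) (t := (Finset.univ : Finset (Config E)))
      (fun _ _ => Finset.mem_univ _),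
    Finset.card_eq_sum_card_fiberwise (f := datum ends h) (t := (Finset.univ : Finset (Config E)))
      (fun _ _ => Finset.mem_univ _)]
  refine Finset.sum_le_sum fun d _ => ?_
  by_cases hne : ((Finset.univ.filter fun ζ : Config E =>
      o ∈ cluster ends (blue ζ) l ∧ h ∈ cluster ends ζ l ∧ h ∉ cluster ends (blue ζ) l ∧
        P (datum ends h ζ)).filter fun ζ => datum ends h ζ = d) = ∅
  · rw [hne, Finset.card_empty]; exact Nat.zero_le _
  obtain ⟨ζ₀, hζ₀⟩ := Finset.nonempty_iff_ne_empty.2 hne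
  rw [Finset.mem_filter, Finset.mem_filter] at hζ₀
  obtain ⟨⟨_, _, _, hhB, hP⟩, hd⟩ := hζ₀
  have hl : l ∉ cluster ends (blue ζ₀) h := by
    simp only [mem_cluster] at hhB ⊢
    exact fun hc => hhB (conn_symm hc)
  -- both classes are cylinders of the datum of `ζ₀`
  have e1 : ((Finset.univ.filter fun ζ : Config E =>
      o ∈ cluster ends (blue ζ) l ∧ h ∈ cluster ends ζ l ∧ h ∉ cluster ends (blue ζ) l ∧
        P (datum ends h ζ)).filter fun ζ => datum ends h ζ = d).card =
      cnt ζ₀ (touchF ends h ζ₀) (blueConnEvent (ends := ends) l o ∩ connEvent ends l h) := by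
    unfold cnt
    congr 1
    ext ζ
    simp only [Finset.mem_filter, Finset.mem_univ, true_and, mem_fib_touchF, ← hd, datum_eq_iff,
      Set.mem_inter_iff, blueConnEvent, connEvent, Set.mem_setOf_eq, mem_cluster]
    constructor
    · rintro ⟨⟨h1, h2, _, _⟩, hag⟩
      exact ⟨hag, h1, h2⟩
    · rintro ⟨hag, h1, h2⟩
      refine ⟨⟨h1, h2, ?_, ?_⟩, hag⟩
      · rw [conn_blue_lh_iff_of_agree hag]; simpa only [mem_cluster] using hhB
      · rw [datum_eq_iff.2 hag]; exact hP
  have e2 : ((Finset.univ.filter fun ζ : Config E =>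
      o ∈ cluster ends ζ l ∧ h ∈ cluster ends ζ l ∧ h ∉ cluster ends (blue ζ) l ∧
        P (datum ends h ζ)).filter fun ζ => datum ends h ζ = d).card =
      cnt ζ₀ (touchF ends h ζ₀) (connEvent ends l o ∩ connEvent ends l h) := by
    unfold cnt
    congr 1
    ext ζ
    simp only [Finset.mem_filter, Finset.mem_univ, true_and, mem_fib_touchF, ← hd, datum_eq_iff,
      Set.mem_inter_iff, connEvent, Set.mem_setOf_eq, mem_cluster]
    constructor
    · rintro ⟨⟨h1, h2, _, _⟩, hag⟩
      exact ⟨hag, h1, h2⟩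
    · rintro ⟨hag, h1, h2⟩
      refine ⟨⟨h1, h2, ?_, ?_⟩, hag⟩
      · rw [conn_blue_lh_iff_of_agree hag]; simpa only [mem_cluster] using hhB
      · rw [datum_eq_iff.2 hag]; exact hP
  rw [e1, e2]
  exact cnt_class_le (ends := ends) (o := o) ζ₀ hl

/-- **The Hall inequality of (RS)**: for every up-set `𝓕` of edge sets,
`#{o ∈ A∖B, c ∈ B∖A, red_in(C_R(c)) ∈ 𝓕} ≤ #{o ∈ A∖B, c ∈ A∖B, blue ∈ 𝓕}`. -/
theorem card_rigidSide_le (l c o : V) (𝓕 : Set (Finset E)) (h𝓕 : IsUpperSet 𝓕) :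
    (Finset.univ.filter fun ζ : Config E =>
        o ∈ rside ends ζ l ∧ c ∈ bside ends ζ l ∧ redIn ends c ζ ∈ 𝓕).card ≤
      (Finset.univ.filter fun ζ : Config E =>
        o ∈ rside ends ζ l ∧ c ∈ rside ends ζ l ∧ blueF ζ ∈ 𝓕).card := by
  -- step 1: the colour swap moves the left side to `{o ∈ B_side, c ∈ R_side, blue_in(C_B(c)) ∈ 𝓕}`
  have step1 : (Finset.univ.filter fun ζ : Config E =>
        o ∈ rside ends ζ l ∧ c ∈ bside ends ζ l ∧ redIn ends c ζ ∈ 𝓕).card ≤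
      (Finset.univ.filter fun ζ : Config E =>
        o ∈ bside ends ζ l ∧ c ∈ rside ends ζ l ∧ blueIn ends c ζ ∈ 𝓕).card := by
    refine Finset.card_le_card_of_injOn blue ?_ ?_
    · intro ζ hζ
      rw [Finset.mem_coe, Finset.mem_filter] at hζ
      rw [Finset.mem_coe, Finset.mem_filter, bside_blue, rside_blue, blueIn_blue]
      exact ⟨Finset.mem_univ _, hζ.2⟩
    · intro ζ₁ _ ζ₂ _ h12
      have := congrArg blue h12
      simpa only [blue_blue] using this
  -- step 2: the one-sided inequality for the datum predicate `blue_in(C_B(c)) ∈ 𝓕`, minus the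
  -- common part `o ∈ A ∩ B`
  have step2 : (Finset.univ.filter fun ζ : Config E =>
        o ∈ bside ends ζ l ∧ c ∈ rside ends ζ l ∧ blueIn ends c ζ ∈ 𝓕).card ≤
      (Finset.univ.filter fun ζ : Config E =>
        o ∈ rside ends ζ l ∧ c ∈ rside ends ζ l ∧ blueIn ends c ζ ∈ 𝓕).card := by
    have key := card_oneSided_le_datum (ends := ends) l c o (fun d => blueIn ends c d ∈ 𝓕)
    simp only [blueIn_datum] at key
    have splitL := Finset.card_filter_add_card_filter_not
      (s := Finset.univ.filter fun ζ : Config E =>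
          o ∈ cluster ends (blue ζ) l ∧ c ∈ cluster ends ζ l ∧ c ∉ cluster ends (blue ζ) l ∧
            blueIn ends c ζ ∈ 𝓕) (fun ζ => o ∈ cluster ends ζ l)
    have splitR := Finset.card_filter_add_card_filter_not
      (s := Finset.univ.filter fun ζ : Config E =>
          o ∈ cluster ends ζ l ∧ c ∈ cluster ends ζ l ∧ c ∉ cluster ends (blue ζ) l ∧
            blueIn ends c ζ ∈ 𝓕) (fun ζ => o ∈ cluster ends (blue ζ) l)
    have eK : ((Finset.univ.filter fun ζ : Config E =>
          o ∈ cluster ends (blue ζ) l ∧ c ∈ cluster ends ζ l ∧ c ∉ cluster ends (blue ζ) l ∧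
            blueIn ends c ζ ∈ 𝓕).filter fun ζ => o ∈ cluster ends ζ l) =
        ((Finset.univ.filter fun ζ : Config E =>
          o ∈ cluster ends ζ l ∧ c ∈ cluster ends ζ l ∧ c ∉ cluster ends (blue ζ) l ∧
            blueIn ends c ζ ∈ 𝓕).filter fun ζ => o ∈ cluster ends (blue ζ) l) := by
      ext ζ; simp only [Finset.mem_filter, Finset.mem_univ, true_and]; tauto
    have eL : ((Finset.univ.filter fun ζ : Config E =>
          o ∈ cluster ends (blue ζ) l ∧ c ∈ cluster ends ζ l ∧ c ∉ cluster ends (blue ζ) l ∧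
            blueIn ends c ζ ∈ 𝓕).filter fun ζ => ¬ o ∈ cluster ends ζ l) =
        (Finset.univ.filter fun ζ : Config E =>
          o ∈ bside ends ζ l ∧ c ∈ rside ends ζ l ∧ blueIn ends c ζ ∈ 𝓕) := by
      ext ζ; simp only [Finset.mem_filter, Finset.mem_univ, true_and, mem_bside_iff, mem_rside_iff]
      tauto
    have eR : ((Finset.univ.filter fun ζ : Config E =>
          o ∈ cluster ends ζ l ∧ c ∈ cluster ends ζ l ∧ c ∉ cluster ends (blue ζ) l ∧
            blueIn ends c ζ ∈ 𝓕).filter fun ζ => ¬ o ∈ cluster ends (blue ζ) l) =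
        (Finset.univ.filter fun ζ : Config E =>
          o ∈ rside ends ζ l ∧ c ∈ rside ends ζ l ∧ blueIn ends c ζ ∈ 𝓕) := by
      ext ζ; simp only [Finset.mem_filter, Finset.mem_univ, true_and, mem_rside_iff]; tauto
    rw [eK, eL] at splitL
    rw [eR] at splitR
    omega
  -- step 3: `blue_in(C_B(c)) ⊆ blue` and `𝓕` is an up-set
  have step3 : (Finset.univ.filter fun ζ : Config E =>
        o ∈ rside ends ζ l ∧ c ∈ rside ends ζ l ∧ blueIn ends c ζ ∈ 𝓕).card ≤
      (Finset.univ.filter fun ζ : Config E =>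
        o ∈ rside ends ζ l ∧ c ∈ rside ends ζ l ∧ blueF ζ ∈ 𝓕).card := by
    apply Finset.card_le_card
    intro ζ hζ
    rw [Finset.mem_filter] at hζ ⊢
    refine ⟨hζ.1, hζ.2.1, hζ.2.2.1, h𝓕 ?_ hζ.2.2.2⟩
    intro e he
    rw [mem_blueIn] at he
    rw [mem_blueF]; exact he.2
  exact step1.trans (step2.trans step3)

/-- The source of (RS): `{o ∈ R_side, c ∈ B_side}`. -/
noncomputable def srcRS (l c o : V) : Finset (Config E) :=
  Finset.univ.filter fun ζ => o ∈ rside ends ζ l ∧ c ∈ bside ends ζ l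

/-- The target of (RS): `{o ∈ R_side, c ∈ R_side}`. -/
noncomputable def tgtRS (l c o : V) : Finset (Config E) :=
  Finset.univ.filter fun ζ => o ∈ rside ends ζ l ∧ c ∈ rside ends ζ l

/-- **The rigid side injection (RS)** (Hall): an injection `{o ∈ R_side, c ∈ B_side} →
{o ∈ R_side, c ∈ R_side}` under which every red edge inside the red cluster of `c` of the source is
blue in the image. -/
theorem exists_rigidSide (l c o : V) :
    ∃ f : {ζ // ζ ∈ srcRS ends l c o} → Config E, Function.Injective f ∧
      ∀ x, f x ∈ tgtRS ends l c o ∧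
        ∀ e, e ∈ within ends (cluster ends x.1 c) → x.1 e = true → f x e = false := by
  let t : {ζ // ζ ∈ srcRS ends l c o} → Finset (Config E) := fun x =>
    (tgtRS ends l c o).filter fun η => ∀ e ∈ redIn ends c x.1, η e = false
  have hall : ∀ s : Finset {ζ // ζ ∈ srcRS ends l c o}, s.card ≤ (s.biUnion t).card := by
    intro s
    obtain ⟨𝓕, h𝓕, h𝓕mem⟩ : ∃ 𝓕 : Set (Finset E), IsUpperSet 𝓕 ∧
        ∀ F, F ∈ 𝓕 ↔ ∃ x ∈ s, redIn ends c x.1 ⊆ F :=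
      ⟨{F | ∃ x ∈ s, redIn ends c x.1 ⊆ F}, fun F F' hFF' ⟨x, hx, hxF⟩ => ⟨x, hx, hxF.trans hFF'⟩,
        fun F => Iff.rfl⟩
    have e1 : s.biUnion t = Finset.univ.filter fun ζ : Config E =>
        o ∈ rside ends ζ l ∧ c ∈ rside ends ζ l ∧ blueF ζ ∈ 𝓕 := by
      ext η
      simp only [Finset.mem_biUnion, Finset.mem_filter, t, tgtRS, Finset.mem_univ, true_and, h𝓕mem]
      constructor
      · rintro ⟨x, hx, ⟨h1, h2⟩, hsub⟩
        exact ⟨h1, h2, x, hx, fun e he => mem_blueF.2 (hsub e he)⟩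
      · rintro ⟨h1, h2, x, hx, hsub⟩
        exact ⟨x, hx, ⟨h1, h2⟩, fun e he => mem_blueF.1 (hsub he)⟩
    have e2 : s.card ≤ (Finset.univ.filter fun ζ : Config E =>
        o ∈ rside ends ζ l ∧ c ∈ bside ends ζ l ∧ redIn ends c ζ ∈ 𝓕).card := by
      refine Finset.card_le_card_of_injOn (fun x => x.1) ?_ ?_
      · intro x hx
        rw [Finset.mem_coe] at hx
        have hx1 := x.2
        simp only [srcRS, Finset.mem_filter, Finset.mem_univ, true_and] at hx1
        simp only [Finset.mem_coe, Finset.mem_filter, Finset.mem_univ, true_and, h𝓕mem]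
        exact ⟨hx1.1, hx1.2, x, hx, subset_rfl⟩
      · intro x _ y _ hxy
        exact Subtype.ext hxy
    rw [e1]
    exact e2.trans (card_rigidSide_le ends l c o 𝓕 h𝓕)
  obtain ⟨f, hf, hft⟩ := (Finset.all_card_le_biUnion_card_iff_exists_injective t).1 hall
  refine ⟨f, hf, fun x => ?_⟩
  have := hft x
  simp only [t, Finset.mem_filter] at this
  exact ⟨this.1, fun e he hred => this.2 e ((mem_redIn ends).2 ⟨he, hred⟩)⟩

end RigidSide

end Summit.Ventures.PercRepro2
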